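import Mathlib.RingTheory.MvPolynomial.Homogeneous
import Literature.NumberTheory.Transcendental.ExpDominantSolvabilityAnalysis
import Literature.NumberTheory.Transcendental.ExpVarieties
import Literature.ModelTheory.ExponentialFields.Languages
import Summits.Schanuel.Schanuel.Theorems.ZilberEacComplexPunctureDecouplingLemmas
import HarnessLib

/-!
# Exponential points by puncture decoupling over a graph hypersurface

A new (modest) case of Zilber's Exponential-Algebraic Closedness conjecture for `ℂ_exp` inside the
first open rung named in the literature — Mantova–Masser, *Polynomial-exponential equations — some
new cases of solvability*, PLMS 129 (2024), §1 p. 5: "It would also be interesting to extend the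
investigations to `π(V)` of other dimensions. The simplest case of dimension 2 in `ℂ³ × ℂˣ³` leads
to systems of equations such as `e^z + e^{z²-w²} = z, e^w + e^{z²-w²} = -w`" — i.e. the range
`dim π₁(V) = n - 1` (`n = 3`), outside the proved cases `dim π₁(V) = n` (Brownawell–Masser 2017
Prop. 2, in tree as `Literature.NumberTheory.Transcendental.BrownawellMasser2017_dominantProjection_holds`),
`dim π₁(V) = 1` (Mantova–Masser 2024 Thm 1.1) and `L × W`, `L` linear (Gallinaro, Selecta 2023,
Thm 8.8); state of the art as listed in Aslanyan–Gallinaro arXiv:2409.12860 §3.4 and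
Dill–Gallinaro arXiv:2506.07550 §1.2.

* `exists_expPoint_punctureDecoupling` — the main theorem (class: additive projection = graph
  hypersurface `xₙ = g(x₁..xₛ)` with a lattice direction `q`, `Re g_D(2πi q) < 0`; fibre equations
  `yⱼ = aⱼ xⱼ + bⱼ + yₙ Fⱼ(yₙ, x)` decoupling at the puncture `yₙ = 0`), with localisation of the
  solutions near `2πi m q`;
* `exists_solution_punctureDecoupling`, `punctureDecoupling_inter_expGraph_nonempty` — solvability /
  the variety meets `Literature.NumberTheory.Transcendental.expGraph`;
* `mantovaMasser_model_system_solvable` — the displayed model system of Mantova–Masser has a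
  solution.

HONEST FRAMING: a modest new sub-rung of EAC; nothing here bears on Schanuel's conjecture (no
implication between EC and SC is known or expected, Aslanyan–Gallinaro 2024 p. 15).
-/

noncomputable section

open Complex MvPolynomial Metric Set Filter Topology

set_option linter.dupNamespace false

namespace Summit.Schanuel.Schanuel.Theorems

/-! ### The main theorem -/

/-- **Exponential points by puncture decoupling over a graph hypersurface.** Let `s ≥ 1`,
`n = s + 1`, `g ∈ ℂ[x₁,…,xₛ]` of total degree `D ≥ 1` with leading form `g_D`, and `q ∈ ℤˢ` a
lattice direction with `Re g_D(2πi q) < 0`. Let `Aⱼ(xⱼ) = aⱼ xⱼ + bⱼ` (`j ≤ s`) be affine with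
`qⱼ ≠ 0` whenever `aⱼ ≠ 0` and `bⱼ ≠ 0` whenever `aⱼ = 0`, and let `Fⱼ ∈ ℂ[u, x₁, …, xₛ]` be
arbitrary. Then the system
`exp (xⱼ) = Aⱼ(xⱼ) + exp (g(x)) · Fⱼ(exp (g(x)), x)` (`j ≤ s`)
has solutions `x ∈ ℂˢ`; more precisely for every large `m ∈ ℕ` there is a solution within sup-distance
`1/2` of the point `x₀(m) = (2πi m qⱼ + log Aⱼ(2πi m qⱼ))ⱼ`. Equivalently (put `xₙ = g(x)`,
`yⱼ = exp xⱼ`): the `n`-dimensional subvariety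
`V = {xₙ = g(x₁,…,xₛ), yⱼ = Aⱼ(xⱼ) + yₙ Fⱼ(yₙ, x₁, …, xₛ) (j ≤ s)} ⊆ ℂⁿ × (ℂˣ)ⁿ`,
whose additive projection is the graph hypersurface `xₙ = g` (so `dim π₁(V) = n - 1`, the
non-dominant range left open by Brownawell–Masser 2017 Prop. 2, Mantova–Masser 2024 Thm 1.1
(`dim π₁ V = 1`) and Gallinaro 2023 Thm 8.8 (`L × W`, `L` linear)), meets the graph of `exp` in
infinitely many points. Mechanism: near the lattice ray `2πi m q` one has `Re g ≤ -c m^D`, so the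
coordinate `yₙ = e^{g}` is exponentially small ("puncture `yₙ → 0`"), the fibre equations decouple
into the one-variable problems `e^{xⱼ} = Aⱼ(xⱼ)`, solved near `2πi m qⱼ`, and the coupling is
absorbed by the contraction lemma of the Brownawell–Masser/D'Aquino–Fornasiero–Terzo Newton
argument (`Literature.NumberTheory.Transcendental.ExpDominant.exists_exp_eq_one_add`). New; the case `s = 2`,
`g = x₁² - x₂²`, `A₁ = x₁`, `A₂ = -x₂`, `F₁ = F₂ = -1` is the model system displayed for the first
open case of Exponential-Algebraic Closedness by Mantova–Masser, PLMS 129 (2024), p. 5.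
[cite: MantovaMasser2023, §1 p.5 (the open case dim π(V) = 2 in ℂ³×ℂˣ³)] -/
theorem exists_expPoint_punctureDecoupling {s : ℕ} (g : MvPolynomial (Fin s) ℂ)
    (hD : 0 < g.totalDegree) (q : Fin s → ℤ)
    (hq : (eval (fun j => 2 * Real.pi * I * (q j : ℂ))
      (homogeneousComponent g.totalDegree g)).re < 0)
    (a b : Fin s → ℂ) (haq : ∀ j, a j ≠ 0 → q j ≠ 0) (hab : ∀ j, a j = 0 → b j ≠ 0)
    (F : Fin s → MvPolynomial (Fin (s + 1)) ℂ) :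
    ∃ m₀ : ℕ, ∀ m : ℕ, m₀ ≤ m → ∃ x : Fin s → ℂ,
      ‖x - fun j => (m : ℂ) * (2 * Real.pi * I * (q j : ℂ)) +
          log (a j * ((m : ℂ) * (2 * Real.pi * I * (q j : ℂ))) + b j)‖ ≤ 1 / 2 ∧
      ∀ j, exp (x j) = a j * x j + b j +
        exp (eval x g) * eval (Fin.cons (exp (eval x g)) x) (F j) := by
  classical
  -- ### constants
  set D := g.totalDegree with hDdef
  set v : Fin s → ℂ := fun j => 2 * Real.pi * I * (q j : ℂ) with hv
  set c₀ : ℝ := -(eval v (homogeneousComponent D g)).re with hc₀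
  have hc₀pos : 0 < c₀ := by rw [hc₀]; linarith
  obtain ⟨ρ, hρ, t₀, ht₀, hnear⟩ :=
    Literature.NumberTheory.Transcendental.ExpDominant.eval_smul_near_top g v (half_pos hc₀pos)
  set w : ℕ → Fin s → ℂ := fun m j => (m : ℂ) * v j with hw
  set α : ℕ → Fin s → ℂ := fun m j => a j * w m j + b j with hαdef
  set x₀ : ℕ → Fin s → ℂ := fun m j => w m j + log (α m j) with hx₀
  have hgrowth := fun j =>
    Literature.NumberTheory.Transcendental.HypersurfaceCover.exists_norm_eval_le_pow (F j)
  choose C hC N hCN using hgrowth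
  set K : ℝ := ‖v‖ + ρ with hK
  have hK0 : 0 ≤ K := by positivity
  have hκ : (0 : ℝ) < 1 / (32 * (s + 1)) := by positivity
  have hcoord := fun j => eventually_affineSeq_bounds (haq j) (hab j) hκ (half_pos hρ)
  choose μ hμ hev using hcoord
  -- ### the exponentially small factor
  have hsmall : ∀ j, ∀ᶠ m : ℕ in atTop,
      C j * (2 + K) ^ N j * ((m : ℝ) ^ N j / Real.exp (c₀ / 2 * m)) ≤ μ j / (32 * (s + 1)) := by
    intro j
    have h := (tendsto_pow_div_exp_natCast (N j) (half_pos hc₀pos)).const_mul (C j * (2 + K) ^ N j)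
    rw [mul_zero] at h
    exact h.eventually_le_const (by have := hμ j; positivity)
  -- ### collect the eventual facts and fix `m`
  have hall : ∀ᶠ m : ℕ in atTop, (t₀ ≤ (m : ℝ) ∧ 1 ≤ ρ / 2 * (m : ℝ)) ∧ ∀ j,
      (μ j ≤ ‖α m j‖ ∧ ‖a j‖ * (‖log (α m j)‖ + 1) ≤ 1 / (32 * (s + 1)) * ‖α m j‖ ∧
        ‖log (α m j)‖ ≤ ρ / 2 * m) ∧
      C j * (2 + K) ^ N j * ((m : ℝ) ^ N j / Real.exp (c₀ / 2 * m)) ≤ μ j / (32 * (s + 1)) := by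
    refine (Filter.Eventually.and ?_ ?_).and (eventually_all.2 fun j => (hev j).and (hsmall j))
    · exact tendsto_natCast_atTop_atTop.eventually_ge_atTop t₀
    · exact (tendsto_natCast_atTop_atTop.const_mul_atTop (half_pos hρ)).eventually_ge_atTop 1
  obtain ⟨m₀, hm₀⟩ := eventually_atTop.1 hall
  refine ⟨m₀, fun m hm => ?_⟩
  obtain ⟨⟨hmt, hmρ⟩, hj⟩ := hm₀ m hm
  have hm1 : (1 : ℝ) ≤ m := ht₀.trans hmt
  have hm0 : (0 : ℝ) < m := by linarith
  have hmC : (m : ℂ) ≠ 0 := by exact_mod_cast hm0.ne'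
  -- ### basic identities
  have hexpw : ∀ j, exp (w m j) = 1 := fun j => exp_natCast_mul_twoPiI_mul_intCast m (q j)
  have hα0 : ∀ j, α m j ≠ 0 := fun j =>
    norm_pos_iff.mp ((hμ j).trans_le (hj j).1.1)
  have hexpx₀ : ∀ j, exp (x₀ m j) = α m j := by
    intro j
    show exp (w m j + log (α m j)) = α m j
    rw [Complex.exp_add, hexpw j, one_mul, Complex.exp_log (hα0 j)]
  -- ### the perturbation and its bound on the unit polydisc around `x₀ m`
  set P : Fin s → (Fin s → ℂ) → ℂ := fun j x =>
    exp (eval x g) * eval (Fin.cons (exp (eval x g)) x) (F j) with hP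
  have hPdiff : ∀ j, Differentiable ℂ (P j) := by
    intro j
    have h1 : Differentiable ℂ fun x : Fin s → ℂ => exp (eval x g) :=
      (differentiable_mvPolynomial_eval g).cexp
    exact h1.mul ((differentiable_mvPolynomial_eval (F j)).comp (differentiable_finCons h1))
  have hPb : ∀ j, ∀ ξ : Fin s → ℂ, ‖ξ‖ < 1 → ‖P j (x₀ m + ξ)‖ ≤ ‖α m j‖ / (32 * (s + 1)) := by
    intro j ξ hξ
    set x : Fin s → ℂ := x₀ m + ξ with hx
    -- distance to the lattice point `m v`
    have hdist : ‖x - (m : ℂ) • v‖ ≤ ρ * m := by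
      have hx' : x - (m : ℂ) • v = (fun j => log (α m j)) + ξ := by
        funext j
        simp only [hx, hx₀, hw, Pi.add_apply, Pi.sub_apply, Pi.smul_apply, smul_eq_mul]
        ring
      rw [hx']
      have hlog : ‖(fun j => log (α m j))‖ ≤ ρ / 2 * m :=
        (pi_norm_le_iff_of_nonneg (by positivity)).2 fun j => (hj j).1.2.2
      calc ‖(fun j => log (α m j)) + ξ‖ ≤ ρ / 2 * m + 1 :=
            (norm_add_le _ _).trans (add_le_add hlog hξ.le)
        _ ≤ ρ * m := by linarith
    -- leading-form asymptotics: `Re g(x) ≤ -(c₀/2) m`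
    set ζ : Fin s → ℂ := (m : ℂ)⁻¹ • (x - (m : ℂ) • v) with hζ
    have hxζ : x = ((m : ℝ) : ℂ) • (v + ζ) := by
      rw [Complex.ofReal_natCast, hζ, smul_add, smul_smul, mul_inv_cancel₀ hmC, one_smul,
        add_sub_cancel]
    have hζρ : ‖ζ‖ ≤ ρ := by
      rw [hζ, norm_smul, norm_inv, Complex.norm_natCast, inv_mul_le_iff₀ hm0, mul_comm]
      exact hdist
    have hg := hnear m hmt ζ hζρ
    rw [← hxζ, Complex.ofReal_natCast] at hg
    have hre : (eval x g).re ≤ -(c₀ / 2 * m) := by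
      have h1 : (eval x g - (m : ℂ) ^ D * eval v (homogeneousComponent D g)).re ≤
          c₀ / 2 * (m : ℝ) ^ D := (Complex.re_le_norm _).trans hg
      have h2 : ((m : ℂ) ^ D * eval v (homogeneousComponent D g)).re = -(c₀ * (m : ℝ) ^ D) := by
        have : (m : ℂ) ^ D = (((m : ℝ) ^ D : ℝ) : ℂ) := by push_cast; rfl
        rw [this, Complex.re_ofReal_mul, hc₀]; ring
      rw [Complex.sub_re, h2] at h1
      have h3 : (m : ℝ) ≤ (m : ℝ) ^ D := le_self_pow₀ hm1 hD.ne'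
      nlinarith
    have hexp_le : ‖exp (eval x g)‖ ≤ (Real.exp (c₀ / 2 * m))⁻¹ := by
      rw [Complex.norm_exp, ← Real.exp_neg]
      exact Real.exp_le_exp.mpr hre
    have hexp_le1 : ‖exp (eval x g)‖ ≤ 1 := by
      refine hexp_le.trans (inv_le_one_of_one_le₀ (Real.one_le_exp (by positivity)))
    -- size of `x` and of `(e^{g(x)}, x)`
    have hxn : ‖x‖ ≤ K * m := by
      calc ‖x‖ = ‖(m : ℂ) • v + (x - (m : ℂ) • v)‖ := by rw [add_sub_cancel]
        _ ≤ ‖(m : ℂ) • v‖ + ‖x - (m : ℂ) • v‖ := norm_add_le _ _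
        _ ≤ m * ‖v‖ + ρ * m := by
            rw [norm_smul, Complex.norm_natCast]; exact add_le_add le_rfl hdist
        _ = K * m := by rw [hK]; ring
    have hcons : ‖(Fin.cons (exp (eval x g)) x : Fin (s + 1) → ℂ)‖ ≤ 1 + K * m :=
      norm_finCons_le hexp_le1 (by positivity) hxn
    have hFb : ‖eval (Fin.cons (exp (eval x g)) x) (F j)‖ ≤ C j * ((2 + K) * m) ^ N j := by
      refine (hCN j _).trans (mul_le_mul_of_nonneg_left ?_ (hC j))
      refine pow_le_pow_left₀ (by positivity) ?_ _
      nlinarith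
    -- conclusion
    have hμle : μ j / (32 * (s + 1)) ≤ ‖α m j‖ / (32 * (s + 1)) :=
      div_le_div_of_nonneg_right (hj j).1.1 (by positivity)
    refine le_trans ?_ ((hj j).2.trans hμle)
    calc ‖P j x‖ = ‖exp (eval x g)‖ * ‖eval (Fin.cons (exp (eval x g)) x) (F j)‖ := norm_mul _ _
      _ ≤ (Real.exp (c₀ / 2 * m))⁻¹ * (C j * ((2 + K) * m) ^ N j) :=
          mul_le_mul hexp_le hFb (norm_nonneg _) (by positivity)
      _ = C j * (2 + K) ^ N j * ((m : ℝ) ^ N j / Real.exp (c₀ / 2 * m)) := by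
          rw [mul_pow, div_eq_mul_inv]; ring
  -- ### the contraction step
  have ha' : ∀ j, ‖a j‖ * (‖log (α m j)‖ + 1) ≤ ‖α m j‖ / (32 * (s + 1)) := by
    intro j
    have := (hj j).1.2.1
    rwa [one_div_mul_eq_div] at this
  obtain ⟨ξ, hξ, hsol⟩ :=
    exists_exp_eq_affine_add (x₀ m) (fun j => log (α m j)) a (α m) P hexpx₀ hα0 hPdiff ha' hPb
  refine ⟨x₀ m + ξ, ?_, fun j => ?_⟩
  · show ‖x₀ m + ξ - x₀ m‖ ≤ 1 / 2
    rwa [add_sub_cancel_left]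
  · have h := hsol j
    simp only [Pi.add_apply] at h ⊢
    rw [h]
    show a j * w m j + b j + a j * (log (α m j) + ξ j) + P j (x₀ m + ξ) =
      a j * (w m j + log (α m j) + ξ j) + b j + P j (x₀ m + ξ)
    ring

/-! ### Corollaries -/

/-- **Solvability** of the decoupled puncture systems: under the hypotheses of
`exists_expPoint_punctureDecoupling`, the system `exp (xⱼ) = aⱼ xⱼ + bⱼ + e^{g(x)} Fⱼ(e^{g(x)}, x)`
(`j ≤ s`) has a solution in `ℂˢ`. [cite: MantovaMasser2023, §1 p.5 (the open case dim π(V) = 2 in ℂ³×ℂˣ³)] -/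
theorem exists_solution_punctureDecoupling {s : ℕ} (g : MvPolynomial (Fin s) ℂ)
    (hD : 0 < g.totalDegree) (q : Fin s → ℤ)
    (hq : (eval (fun j => 2 * Real.pi * I * (q j : ℂ))
      (homogeneousComponent g.totalDegree g)).re < 0)
    (a b : Fin s → ℂ) (haq : ∀ j, a j ≠ 0 → q j ≠ 0) (hab : ∀ j, a j = 0 → b j ≠ 0)
    (F : Fin s → MvPolynomial (Fin (s + 1)) ℂ) :
    ∃ x : Fin s → ℂ, ∀ j, exp (x j) = a j * x j + b j +
        exp (eval x g) * eval (Fin.cons (exp (eval x g)) x) (F j) := by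
  obtain ⟨m₀, hm₀⟩ := exists_expPoint_punctureDecoupling g hD q hq a b haq hab F
  obtain ⟨x, -, hx⟩ := hm₀ m₀ le_rfl
  exact ⟨x, hx⟩

/-- **The variety meets the graph of exponentiation** (Exponential-Algebraic Closedness for this
class, in the vocabulary of `Literature.NumberTheory.Transcendental.expGraph`): with `n = s + 1`, the subvariety
`V = {xₙ = g(x₁..xₛ), yⱼ = aⱼ xⱼ + bⱼ + yₙ Fⱼ(yₙ, x₁..xₛ) (j ≤ s)}` of `ℂⁿ × ℂⁿ` (points
`z : Fin n ⊕ Fin n → ℂ`, additive block `inl`, multiplicative block `inr`; the last index `Fin.last s`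
is the distinguished coordinate `n`) contains a point of the graph of `exp` — hence of
`ℂⁿ × (ℂˣ)ⁿ`, `expGraph ⊆ torusLocus`. Its additive projection is the graph hypersurface `xₙ = g`,
of dimension `n - 1 < n`. [cite: MantovaMasser2023, §1 p.5 (the open case dim π(V) = 2 in ℂ³×ℂˣ³)] -/
theorem punctureDecoupling_inter_expGraph_nonempty {s : ℕ} (g : MvPolynomial (Fin s) ℂ)
    (hD : 0 < g.totalDegree) (q : Fin s → ℤ)
    (hq : (eval (fun j => 2 * Real.pi * I * (q j : ℂ))
      (homogeneousComponent g.totalDegree g)).re < 0)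
    (a b : Fin s → ℂ) (haq : ∀ j, a j ≠ 0 → q j ≠ 0) (hab : ∀ j, a j = 0 → b j ≠ 0)
    (F : Fin s → MvPolynomial (Fin (s + 1)) ℂ) :
    ({z : Fin (s + 1) ⊕ Fin (s + 1) → ℂ |
        z (Sum.inl (Fin.last s)) = eval (fun j => z (Sum.inl (Fin.castSucc j))) g ∧
        ∀ j : Fin s, z (Sum.inr (Fin.castSucc j)) =
          a j * z (Sum.inl (Fin.castSucc j)) + b j +
            z (Sum.inr (Fin.last s)) *
              eval (Fin.cons (z (Sum.inr (Fin.last s))) fun j => z (Sum.inl (Fin.castSucc j)))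
                (F j)} ∩
      Literature.NumberTheory.Transcendental.expGraph ℂ (s + 1)).Nonempty := by
  obtain ⟨x, hx⟩ := exists_solution_punctureDecoupling g hD q hq a b haq hab F
  set X : Fin (s + 1) → ℂ := Fin.snoc x (eval x g) with hX
  refine ⟨Sum.elim X fun i => exp (X i), ⟨?_, fun j => ?_⟩, fun i => ?_⟩
  · simp [hX, Fin.snoc_last, Fin.snoc_castSucc]
  · simp only [Sum.elim_inl, Sum.elim_inr, hX, Fin.snoc_castSucc, Fin.snoc_last]
    exact hx j
  · simp [Literature.ModelTheory.ExponentialFields.ExponentialRing.complex_exp_eq]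

/-- **Mantova–Masser's model system for the first open case of Exponential-Algebraic Closedness is
solvable.** Mantova–Masser, *Polynomial-exponential equations — some new cases of solvability*,
PLMS 129 (2024), §1 p. 5: "It would also be interesting to extend the investigations to `π(V)` of
other dimensions. The simplest case of dimension 2 in `ℂ³ × ℂˣ³` leads to systems of equations
such as `e^z + e^{z²-w²} = z`, `e^w + e^{z²-w²} = -w`." This system has a complex solution
(indeed solutions near `(2πi·2m + log(4πi m), 2πi m + log(-2πi m))` for every large `m`): the case
`s = 2`, `g = x₁² - x₂²`, `q = (2, 1)` (`g(2πi q) = -12π² < 0`), `A₁ = x₁`, `A₂ = -x₂`,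
`F₁ = F₂ = -1` of `exists_expPoint_punctureDecoupling`.
[cite: MantovaMasser2023, §1 p.5 (displayed system for dim π(V) = 2 in ℂ³×ℂˣ³)] -/
theorem mantovaMasser_model_system_solvable :
    ∃ z w : ℂ, exp z + exp (z ^ 2 - w ^ 2) = z ∧ exp w + exp (z ^ 2 - w ^ 2) = -w := by
  set g : MvPolynomial (Fin 2) ℂ := X 0 ^ 2 - X 1 ^ 2 with hg
  have hhom : g.IsHomogeneous 2 := (isHomogeneous_X_pow 0 2).sub (isHomogeneous_X_pow 1 2)
  have heval : ∀ x : Fin 2 → ℂ, eval x g = x 0 ^ 2 - x 1 ^ 2 := fun x => by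
    simp [hg, map_sub, map_pow, eval_X]
  have hg0 : g ≠ 0 := by
    intro h
    have := heval ![1, 0]
    rw [h, map_zero] at this
    norm_num at this
  have hdeg : g.totalDegree = 2 := hhom.totalDegree hg0
  set q : Fin 2 → ℤ := ![2, 1] with hq
  have hqre : (eval (fun j => 2 * Real.pi * I * (q j : ℂ))
      (homogeneousComponent g.totalDegree g)).re < 0 := by
    rw [hdeg, homogeneousComponent_eq_self hhom, heval]
    have h1 : (2 * (Real.pi : ℂ) * I * ((q 0 : ℤ) : ℂ)) ^ 2 - (2 * Real.pi * I * ((q 1 : ℤ) : ℂ)) ^ 2 =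
        ((-12 * Real.pi ^ 2 : ℝ) : ℂ) := by
      simp only [hq, Matrix.cons_val_zero, Matrix.cons_val_one]
      push_cast
      ring_nf
      rw [Complex.I_sq]
      ring
    rw [h1, Complex.ofReal_re]
    have := Real.pi_pos
    nlinarith
  obtain ⟨x, hx⟩ := exists_solution_punctureDecoupling g (by rw [hdeg]; norm_num) q hqre
    ![1, -1] ![0, 0] (fun j => by fin_cases j <;> simp [hq]) (fun j => by fin_cases j <;> simp)
    (fun _ => C (-1))
  refine ⟨x 0, x 1, ?_, ?_⟩
  · have h := hx 0
    simp only [heval, eval_C, Matrix.cons_val_zero] at h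
    linear_combination h
  · have h := hx 1
    simp only [heval, eval_C, Matrix.cons_val_one, Matrix.cons_val_fin_one] at h
    linear_combination h

end Summit.Schanuel.Schanuel.Theorems
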